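import Summits.CriticalPhenomena.Ising3D.Control2DReadoutKernel
import Mathlib.Tactic.Ring
import Mathlib.Tactic.NormNum
import HarnessLib

/-!
# Readout certificates: a FAST exact evaluator of the `u`-vector (binomial rows in one pass, the `s`-convolution taken once at
the end) — same values as `Control2DReadoutKernel.uVecQ`, ≈ Λ/2 times fewer rational operations in the kernel (cell `pub-ising3x`,
seat controls-1 gen 30; KERNEL PATH, certificate kind "readout" — CONTROL-ONLY)

HONEST FRAMING: lottery ticket; floor = tightest certified 3D Ising CFT bounds; no exact-solution
claim without a proof. CONTROL-ONLY (`d = 2`); nothing numerical is asserted here.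

`uVecQ s h N Λ` (controls-1 g29) evaluates `u_k(h) = Σ_{m<N} a_m(h) 2^{-m} q¹(s, h+m; k)`, `k = 0..Λ`, level by level with
`q¹(s, α; k) = Σ_{i+j=k} (-1)^i C(s,i) C(α,j)` recomputed from scratch for every `k` (`qVecQ`: `O(Λ³)` rational products per level —
measured on the farm: the binomial convolutions are essentially ALL of the kernel time of a readout check). Exchanging the two finite
sums, `u_k(h) = Σ_{i ≤ k} (-1)^i C(s,i) · B_{k-i}(h)` with `B_j(h) = Σ_{m<N} a_m(h) 2^{-m} C(h+m, j)` (`uSumQ_eq_conv`), so it suffices to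
accumulate the vector `B_0..B_Λ` level by level from the binomial ROW `C(h+m, 0..Λ)` — one pass of the ratio recursion (`chooseRowF`,
`Λ` products) — and to convolve once at the end (`uVecF`; `O(Λ)` products per level). `uVecF_getD : (uVecF s h N Λ)[k] = uSumQ s h N k`
(`k ≤ Λ`), so every head built on `uVecQ` has a drop-in fast twin (`Control2DReadoutSpinKernel.headSpinQf`). Pure list/ℚ bookkeeping;
no facts, standard axioms only. [folklore]
-/

namespace Summit.CriticalPhenomena.Ising3D.Control2D

open Finset

/-! ### `sumRangeQ` bookkeeping -/

/-- `sumRangeQ` is the `Finset.range` sum (in `ℚ`). [folklore] -/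
theorem sumRangeQ_eq_sum (f : ℕ → ℚ) : ∀ n : ℕ, sumRangeQ f n = ∑ i ∈ range n, f i
  | 0 => by simp [sumRangeQ]
  | n + 1 => by rw [sumRangeQ, sumRangeQ_eq_sum f n, Finset.sum_range_succ]

/-- [folklore] -/
theorem sumRangeQ_congr {f g : ℕ → ℚ} {n : ℕ} (h : ∀ i < n, f i = g i) : sumRangeQ f n = sumRangeQ g n := by
  rw [sumRangeQ_eq_sum, sumRangeQ_eq_sum]
  exact Finset.sum_congr rfl fun i hi => h i (Finset.mem_range.mp hi)

/-! ### The binomial row `C(α, 0..Λ)` in one pass -/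

/-- One pass of the ratio recursion: `(C(α, n), [C(α, n), …, C(α, 0)])`. [folklore] -/
def chooseRowGo (α : ℚ) : ℕ → ℚ × List ℚ
  | 0 => (1, [1])
  | n + 1 =>
      let c := (chooseRowGo α n).1 * (α - n) / (n + 1)
      (c, c :: (chooseRowGo α n).2)

/-- [folklore] -/
theorem chooseRowGo_fst (α : ℚ) : ∀ n : ℕ, (chooseRowGo α n).1 = chooseQ α n
  | 0 => by simp [chooseRowGo, chooseQ]
  | n + 1 => by rw [chooseRowGo, chooseQ, ← chooseRowGo_fst α n]

/-- [folklore] -/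
theorem chooseRowGo_snd (α : ℚ) : ∀ n : ℕ, (chooseRowGo α n).2 = ((List.range (n + 1)).map (chooseQ α)).reverse
  | 0 => by simp [chooseRowGo, chooseQ]
  | n + 1 => by
      rw [chooseRowGo, List.range_succ, List.map_append, List.reverse_append, List.map_singleton, List.reverse_singleton,
        List.singleton_append, ← chooseRowGo_snd α n, chooseQ, ← chooseRowGo_fst α n]

/-- The binomial row `[C(α,0), …, C(α,Λ)]`, fast form. [folklore] -/
def chooseRowF (α : ℚ) (Λ : ℕ) : List ℚ := (chooseRowGo α Λ).2.reverse

/-- [folklore] -/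
theorem chooseRowF_eq (α : ℚ) (Λ : ℕ) : chooseRowF α Λ = (List.range (Λ + 1)).map (chooseQ α) := by
  rw [chooseRowF, chooseRowGo_snd, List.reverse_reverse]

/-- [folklore] -/
theorem chooseRowF_getElem? (α : ℚ) {Λ j : ℕ} (hj : j ≤ Λ) : (chooseRowF α Λ)[j]? = some (chooseQ α j) := by
  rw [chooseRowF_eq, List.getElem?_map, List.getElem?_range (Nat.lt_succ_of_le hj)]
  rfl

/-! ### The binomial moments `B_j(h) = Σ_{m<N} a_m(h) 2^{-m} C(h+m, j)` in one pass -/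

/-- `B_j(h)` (spec). [folklore] -/
def bSumQ (h : ℚ) (N j : ℕ) : ℚ := sumRangeQ (fun m => aQ h m * (1 / 2) ^ m * chooseQ (h + m) j) N

/-- The one-pass state `([B_0, …, B_Λ] after m levels, a_m 2^{-m})`. [folklore] -/
def bVecGo (h : ℚ) (Λ : ℕ) : ℕ → List ℚ × ℚ
  | 0 => (List.replicate (Λ + 1) 0, 1)
  | m + 1 =>
      (List.zipWith (fun x b => x + (bVecGo h Λ m).2 * b) (bVecGo h Λ m).1 (chooseRowF (h + m) Λ),
        (bVecGo h Λ m).2 * ((h + m) ^ 2 / ((m + 1) * (2 * h + m))) / 2)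

/-- `[B_0(h), …, B_Λ(h)]` (`N` levels), fast form. [folklore] -/
def bVecQ (h : ℚ) (N Λ : ℕ) : List ℚ := (bVecGo h Λ N).1

/-- [folklore] -/
theorem bVecGo_snd (h : ℚ) (Λ : ℕ) : ∀ m : ℕ, (bVecGo h Λ m).2 = aQ h m * (1 / 2) ^ m
  | 0 => by simp [bVecGo, aQ]
  | m + 1 => by rw [bVecGo, bVecGo_snd h Λ m, aQ, pow_succ]; ring

/-- [folklore] -/
theorem bVecGo_getElem? (h : ℚ) (Λ : ℕ) {j : ℕ} (hj : j ≤ Λ) : ∀ m : ℕ, ((bVecGo h Λ m).1)[j]? = some (bSumQ h m j)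
  | 0 => by
      simp only [bVecGo, bSumQ, sumRangeQ]
      rw [List.getElem?_replicate]
      simp [Nat.lt_succ_of_le hj]
  | m + 1 => by
      have ih := bVecGo_getElem? h Λ hj m
      rw [bVecGo, List.getElem?_zipWith, ih, chooseRowF_getElem? _ hj, bVecGo_snd h Λ m]
      rfl

/-- [folklore] -/
theorem bVecQ_getD (h : ℚ) (N Λ : ℕ) {j : ℕ} (hj : j ≤ Λ) : (bVecQ h N Λ)[j]?.getD 0 = bSumQ h N j := by
  rw [bVecQ, bVecGo_getElem? h Λ hj N]
  rfl

/-! ### The `u`-vector by one final convolution -/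

/-- `(-1)^i C(s, i)`. [folklore] -/
def csQ (s : ℚ) (i : ℕ) : ℚ := (-1) ^ i * chooseQ s i

/-- **Sum exchange**: `u_k(h) = Σ_{i ≤ k} (-1)^i C(s,i) B_{k-i}(h)`. [folklore] -/
theorem uSumQ_eq_conv (s h : ℚ) (N k : ℕ) :
    uSumQ s h N k = sumRangeQ (fun i => csQ s i * bSumQ h N (k - i)) (k + 1) := by
  rw [uSumQ, uSumGo_fst]
  simp only [sumRangeQ_eq_sum, qQ, bSumQ, csQ, Finset.mul_sum]
  rw [Finset.sum_comm]
  refine Finset.sum_congr rfl fun i _ => Finset.sum_congr rfl fun m _ => ?_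
  ring

/-- **The fast `u`-vector** `[u_0(h), …, u_Λ(h)]`: the moment vector once, then one convolution with `(-1)^i C(s,i)`. [folklore] -/
def uVecF (s h : ℚ) (N Λ : ℕ) : List ℚ :=
  let bs := bVecQ h N Λ
  (List.range (Λ + 1)).map fun k => sumRangeQ (fun i => csQ s i * bs[k - i]?.getD 0) (k + 1)

/-- The fast `u`-vector agrees entry by entry with `uSumQ` (hence with `uVecQ`). [folklore] -/
theorem uVecF_getD (s h : ℚ) (N Λ : ℕ) {k : ℕ} (hk : k ≤ Λ) : (uVecF s h N Λ)[k]?.getD 0 = uSumQ s h N k := by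
  dsimp only [uVecF]
  rw [List.getElem?_map, List.getElem?_range (Nat.lt_succ_of_le hk), Option.map_some, Option.getD_some, uSumQ_eq_conv]
  refine sumRangeQ_congr fun i _ => ?_
  rw [bVecQ_getD h N Λ (by omega : k - i ≤ Λ)]

/-- … and with the one-pass vector of `Control2DReadoutKernel`. [folklore] -/
theorem uVecF_getD_eq_uVecQ_getD (s h : ℚ) (N Λ : ℕ) {k : ℕ} (hk : k ≤ Λ) :
    (uVecF s h N Λ)[k]?.getD 0 = (uVecQ s h N Λ)[k]?.getD 0 := by
  rw [uVecF_getD s h N Λ hk, uVecQ_getD s h N Λ hk]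

end Summit.CriticalPhenomena.Ising3D.Control2D
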